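import Literature.Geometry.Lorentzian.Stationary
import Literature.Geometry.Lorentzian.LeviCivitaProofs
import Literature.Geometry.Lorentzian.CompleteStationaryVacuumFlatProofs

/-!
# `ErgoregionBombModT` — at a Killing light point every `T`-invariant function has
# `Hess f (T, T) = 0` (crux stmt-FinalStateConjecture-17838, line `killing-light-points`, lead c3)

Route `ZeroEnergyKerrOrBomb` of the Final State Conjecture, crux
`Summit.FinalStateConjecture.FinalStateConjecture.Theses.ZeroEnergyKerrOrBomb.ErgoregionBombModT`,
skeleton v4 of line `killing-light-points`: the crux is, losslessly, `OffWallBomb ∧ LightPointBomb`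
(p139708), `LightPointBomb` being the crux restricted to Killing light points — points `p` of the
d.o.c. with `g(T,T)(p) = 0` and `∇_T T = κ T`.  This file records the second-order identity that
makes light points an obstruction to BOTH engines of the route:

* `hessian_killing_killing_eq_neg_mfderiv_leviCivita` — for the stationary Killing field `T` and a
  function `f` of class `C²` at `p` which is `T`-invariant near `p` (`df(T) = 0` on a neighbourhood),
  `Hess f (p)(T, T) = -df_p(∇_T T)`: O'Neill's formula `H^f(X,Y) = X(Yf) - (∇_X Y) f`
  (`PseudoRiemannianMetric.hessian_apply_holds`, Ch. 3 Lemma 3.49) with `X = Y = T`, the first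
  term vanishing because `Tf ≡ 0` near `p`;
* `hessian_killing_killing_eq_zero_of_lightPoint` — hence at a light point (`∇_T T = κ T`)
  `Hess f (p)(T, T) = -κ (Tf)(p) = 0` for EVERY such `f` (registered certificate of the crux item).

Reading (for the planners; nothing below depends on it): the unique-continuation engine behind
`NonTrappingHawkingRigidity` (Ionescu–Klainerman 2009/2013, Alexakis–Ionescu–Klainerman 2010)
sweeps the d.o.c. with `T`-invariant hypersurfaces `{f = c}` that must be `T`-conditionally
pseudo-convex: `Hess f (X, X) < 0` for null `X` tangent to the level set with `g(X, T) = 0`.  At a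
light point `X = T` itself is such a vector (null, tangent since `Tf = 0`, `g(T,T) = 0`), and the
lemma says `Hess f (T, T) = 0` whatever `f` is: no `T`-invariant sweep surface is pseudo-convex at a
light point.  So the light-point half `LightPointBomb` of the crux is an orphan of both sides of the
route's dichotomy — the Carleman rigidity engine cannot cross a light line, and the bomb heuristics
(Friedman / Moschidis) need `g(T,T) > 0` — which is the lead's case for restating the crux to its
off-wall half and filing "no light point in the d.o.c." as a uniqueness-type support statement.

References: B. O'Neill, *Semi-Riemannian geometry* (1983), Ch. 3, Def. 3.48–Lemma 3.49;
A. D. Ionescu, S. Klainerman, Invent. Math. 175 (2009) 35, §3 (T-conditional pseudo-convexity);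
A. D. Ionescu, S. Klainerman, Surveys in Differential Geometry 20 (2015), §4; crux workfiles
`Cruxes/ErgoregionBombModT/Lines/killing_light_points.lean` (skeleton v4), `Lines/killing-light-points.md`.
-/

noncomputable section

open Bundle Set Filter Function
open scoped Manifold Topology

-- summit = problem name (D-0017)
set_option linter.dupNamespace false

namespace Summit.FinalStateConjecture.FinalStateConjecture.Theorems.ErgoregionBombModT

open Literature.Geometry.Lorentzian

section LightPointHessian

variable {𝓑 : StationaryAFBlackHole.{0}} [𝓑.metric.HasLeviCivita]

omit [𝓑.metric.HasLeviCivita] in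
/-- A real function which vanishes identically near `p` has `mvfderiv = 0` at `p` (the derivative
is local: `Filter.EventuallyEq.mfderiv_eq`, `mfderiv_const`). [folklore] -/
private theorem mvfderiv_eq_zero_of_eventuallyEq_zero {H : 𝓑.carrier → ℝ} {p : 𝓑.carrier}
    (h : H =ᶠ[𝓝 p] fun _ ↦ (0 : ℝ)) : mvfderiv (𝓡 4) H p = 0 := by
  unfold mvfderiv
  rw [h.mfderiv_eq, mfderiv_const]
  ext v
  rfl

/-- **`Hess f (T, T) = -df(∇_T T)` for a `T`-invariant function.**  For the stationary Killing
field `T` of `𝓑`, a function `f` of class `C²` at `p` with `df(T) = 0` on a neighbourhood of `p`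
satisfies `Hess f (p)(T_p, T_p) = -df_p(∇_T T (p))`: by O'Neill's formula
`H^f(X, Y) = X(Y f) - (∇_X Y) f` (`PseudoRiemannianMetric.hessian_apply_holds`) with `X = Y = T`,
where `T(Tf)(p) = 0` because `Tf` vanishes identically near `p`.  O'Neill 1983, Ch. 3,
Def. 3.48 and Lemma 3.49. [cite: ONeill1983, Ch. 3, Def. 3.48 and Lemma 3.49] -/
theorem hessian_killing_killing_eq_neg_mfderiv_leviCivita {f : 𝓑.carrier → ℝ} {p : 𝓑.carrier}
    (hf : ContMDiffAt (𝓡 4) 𝓘(ℝ, ℝ) 2 f p)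
    (hinv : ∀ᶠ x in 𝓝 p, mfderiv (𝓡 4) 𝓘(ℝ, ℝ) f x (𝓑.killing x) = 0) :
    𝓑.metric.toPseudoRiemannianMetric.hessian f p (𝓑.killing p) (𝓑.killing p) =
      - mfderiv (𝓡 4) 𝓘(ℝ, ℝ) f p (𝓑.metric.leviCivita 𝓑.killing p (𝓑.killing p)) := by
  have hT : MDifferentiableAt (𝓡 4) (𝓡 4).tangent
      (fun x ↦ (TotalSpace.mk' E4 x (𝓑.killing x) : TangentBundle (𝓡 4) 𝓑.carrier)) p :=
    𝓑.isStationaryKilling.isKillingField.mdifferentiableAt p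
  rw [PseudoRiemannianMetric.hessian_apply_holds (g := 𝓑.metric.toPseudoRiemannianMetric)
    (x := p) (f := f) hf hT hT]
  -- the first term of `hessianAux` vanishes: `y ↦ df_y(T_y)` is identically `0` near `p`
  have hzero : (fun y ↦ mvfderiv (𝓡 4) f y (𝓑.killing y)) =ᶠ[𝓝 p] fun _ ↦ (0 : ℝ) := by
    filter_upwards [hinv] with y hy
    exact hy
  have h1 : mvfderiv (𝓡 4) (fun y ↦ mvfderiv (𝓡 4) f y (𝓑.killing y)) p (𝓑.killing p) = 0 := by
    rw [mvfderiv_eq_zero_of_eventuallyEq_zero hzero]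
    rfl
  unfold PseudoRiemannianMetric.hessianAux
  rw [h1, zero_sub]
  rfl

/-- **At a Killing light point, `Hess f (T, T) = 0` for every `T`-invariant `C²` function.**  If
`∇_T T = κ T` at `p` then, for `f` of class `C²` at `p` with `df(T) = 0` near `p`,
`Hess f (p)(T_p, T_p) = -df_p(κ T_p) = -κ (Tf)(p) = 0`
(`hessian_killing_killing_eq_neg_mfderiv_leviCivita`).  Consequence recorded in the module
docstring: no `T`-invariant hypersurface through a light point is `T`-conditionally pseudo-convex
there (Ionescu–Klainerman).  Registered certificate `hessian_killing_killing_eq_zero_of_lightPoint`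
of crux stmt-FinalStateConjecture-17838 (a certificate, not an obligation of the skeleton).
O'Neill 1983, Ch. 3, Lemma 3.49. [cite: ONeill1983, Ch. 3, Def. 3.48 and Lemma 3.49] -/
theorem hessian_killing_killing_eq_zero_of_lightPoint :
    ∀ (𝓑 : Literature.Geometry.Lorentzian.StationaryAFBlackHole.{0}) [𝓑.metric.HasLeviCivita] (f : 𝓑.carrier → ℝ) (p : 𝓑.carrier) (κ : ℝ), ContMDiffAt (𝓡 4) 𝓘(ℝ, ℝ) 2 f p → Filter.Eventually (fun x ↦ mfderiv (𝓡 4) 𝓘(ℝ, ℝ) f x (𝓑.killing x) = 0) (nhds p) → 𝓑.metric.leviCivita 𝓑.killing p (𝓑.killing p) = κ • 𝓑.killing p → 𝓑.metric.toPseudoRiemannianMetric.hessian f p (𝓑.killing p) (𝓑.killing p) = 0 := by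
  intro 𝓑 _ f p κ hf hinv hacc
  rw [hessian_killing_killing_eq_neg_mfderiv_leviCivita hf hinv, hacc, map_smul, hinv.self_of_nhds,
    smul_zero, neg_zero]
  rfl

end LightPointHessian

end Summit.FinalStateConjecture.FinalStateConjecture.Theorems.ErgoregionBombModT

end
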